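import Summits.QuantumFields.QCD.Theses.GapBuysCauchyRate
import Summits.QuantumFields.QCD.Theses.CounterexampleMustBeHot
import Summits.QuantumFields.QCD.Theorems.QuarksAsStableActionStableActionBridgeDefs
import Literature.MathematicalPhysics.QuantumFieldTheory.MassGapFromLatticeClustering
import Summits.QuantumFields.QCD.Theorems.GapBuysCauchyRateConvergentOSClosureStubSoftClosure
import Summits.QuantumFields.QCD.Theorems.GapBuysCauchyRateConvergentOSClosureStubAsymptoticTranslation
import Summits.QuantumFields.QCD.Theorems.GapBuysCauchyRateConvergentOSClosureStubSpeciesPackaging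
import Summits.QuantumFields.QCD.Theorems.GapBuysCauchyRateConvergentOSClosureStubRpOfComparison
import Literature.MathematicalPhysics.QuantumFieldTheory.QCDAsymptoticScalingCouplingDivergence
import HarnessLib.Audit

/-!
# Re-type deliverable for crux `ConvergentOSClosure` (item stmt-QuantumFields-11525) — lead c2, 2026-08-17

For the PLANNER.  The byte-exact re-typed statement R′ in the vocabulary and style of the route file
(`def … : Prop := open … in ∀ …`, one line), checked to elaborate in the Theses context with exactly TWO extra imports

* `Summits.QuantumFields.QCD.Theorems.QuarksAsStableActionStableActionBridgeDefs` (`qcdLatticeDist`, `qcdLatticeDistSymAP`,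
  namespace `Summit.QuantumFields.QCD.Cruxes.StableActionBridge.Sketch` — add it to the `open … in` list as below, or
  fully qualify the two names), and
* `Literature.MathematicalPhysics.QuantumFieldTheory.MassGapFromLatticeClustering` (`QCDScheme.HasSpeciesCSClustering`),

together with its closing proof from the LANDED theorem files (p149834, p150754, p147393, p152669) — after the re-type the
item closes with the 12-line `convergentOSClosureRetyped_holds` below (copy it into
`Theorems/GapBuysCauchyRateConvergentOSClosure.lean` with the statement `GapBuysCauchyRate.ConvergentOSClosure`).
The one-line text is the whitespace-join of `Restatement.lean` lines 188–228 (`ConvergentOSClosureR'`; the Cruxes module is not a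
farm build target, so the `Iff.rfl` identity is not re-checked here); `retyped_of_original` certifies that re-typing loses nothing (the crux as typed implies R′: R′ only ADDS hypotheses
and restricts to `N_f ≤ 16`).  Both route copies (`GapBuysCauchyRate.ConvergentOSClosure`, stmt-11525, and
`CounterexampleMustBeHot.ConvergentOSClosure`) are the same term today (`copies_agree`, `Iff.rfl`), so ONE re-typed text serves both.

What R′ adds to the typed hypotheses, per `(reg, 𝒞, m)` (see LEAD-SUMMARY.md / LEAD2-ASSESSMENT.md / LEAD3-ASSESSMENT.md):
`N_f ≤ 16`; (T ∧ COMP) one norm index `s` with a k-uniform E0′ bound of `qcdLatticeDist` on `⁰𝒮` AND the ε-uniform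
E0′-norm comparison periodic ↔ Θ-symmetrised thermal distributions; (CL) k-uniform spatial clustering; (CS)
`∃ Δ' > 0, HasSpeciesCSClustering Δ'`.  `LadderCauchyRate` (stmt-17307) / `ChiralCalibratedConvergence` (stmt-18044) must
emit the same clauses for the assemblies to re-certify.
-/

namespace Summit.QuantumFields.QCD.Cruxes.ConvergentOSClosure.Retype

open scoped BigOperators Topology
open Filter

/-- **THE RE-TYPED CRUX (R′), route-file style.**  Signature text for `ledger route edit` = everything after `:=`. -/
def ConvergentOSClosureRetyped : Prop :=
  open Literature.MathematicalPhysics.QuantumFieldTheory Literature.MathematicalPhysics.QuantumLattice Literature.MathematicalPhysics.AQFT Summit.QuantumFields.QCD.Cruxes.StableActionBridge.Sketch in ∀ (Nf : ℕ) (reg : QCDRegularisation Nf) (𝒞 : CalibratedSpeciesFamily reg) (m : Fin Nf → ℝ), Nf ≤ 16 → (∀ f, 0 < m f) → (𝒞.scheme m).HasAsymptoticScaling → (∀ fl : Fin Nf, ∀ᶠ k in Filter.atTop, -1 < (𝒞.scheme m).mq fl k) → (∃ Δ > 0, (𝒞.scheme m).HasLatticeMassGap Δ) → (∀ᶠ k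 in Filter.atTop, (𝒞.scheme m).twoPoint k QCDField.glue QCDField.glue (thetaTest 4 𝒞.f₀) 𝒞.f₀ = 1) → (∀ f g : Fin Nf, f ≠ g → ∀ᶠ k in Filter.atTop, (𝒞.scheme m).twoPoint k (QCDField.pseudoRe f g) (QCDField.pseudoRe f g) (thetaTest 4 𝒞.f₀) 𝒞.f₀ = 1) → (∃ f g h : SchwartzMap (EuclideanSpace ℝ (Fin 4)) ℝ, tsupport (f : EuclideanSpace ℝ (Fin 4) → ℝ) ⊆ {x | x 0 < 0} ∧ tsupport (g : EuclideanSpace ℝ (Fin 4) → ℝ) ⊆ {x | 0 < x 0 ∧ x 0 < 1} ∧ tsupport (h : EuclideanSpace ℝ (Fin 4) → ℝ) ⊆ {x | 1 < x 0} ∧ ∃ ε > (0 : ℝ), ∀ᶠ k in Filter.atTop, ε ≤ ‖qcdLatticeSchwinger (𝒞.scheme m) k 3 ![QCDField.glue, QCDField.glue, QCDField.glue] ![f, g, h] - qcdLatticeSchwinger (𝒞.scheme m) k 1 ![QCDField.glue] ![f] * qcdLatticeSchwinger (𝒞.scheme m) k 2 ![QCDField.glue, QCDField.glue] ![g, h]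 - qcdLatticeSchwinger (𝒞.scheme m) k 1 ![QCDField.glue] ![g] * qcdLatticeSchwinger (𝒞.scheme m) k 2 ![QCDField.glue, QCDField.glue] ![f, h] - qcdLatticeSchwinger (𝒞.scheme m) k 1 ![QCDField.glue] ![h] * qcdLatticeSchwinger (𝒞.scheme m) k 2 ![QCDField.glue, QCDField.glue] ![f, g] + 2 * (qcdLatticeSchwinger (𝒞.scheme m) k 1 ![QCDField.glue] ![f] * qcdLatticeSchwinger (𝒞.scheme m) k 1 ![QCDField.glue] ![g] * qcdLatticeSchwinger (𝒞.scheme m) k 1 ![QCDField.glue] ![h])‖) → (∀ n : ℕ, n ≠ 0 → ∀ (σ : Fin n → QCDField Nf) (f : Fin n → SchwartzMap (EuclideanSpace ℝ (Fin 4)) ℝ) (F : SchwartzMap (Fin n → EuclideanSpace ℝ (Fin 4)) ℂ), IsTensorOf F (fun i => ofRealTest (f i)) → IsOffDiagonal F → ∃ c : ℂ, Filter.Tendsto (fun k : ℕ => qcdLatticeSchwinger (𝒞.scheme m) k n σ f) Filter.atTop (nhds c)) → (∃ (s : ℕ) (α β : ℝ), 0 ≤ α ∧ (∀ (n : ℕ)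 (σ : Fin n → QCDField Nf), ∀ᶠ k in Filter.atTop, ∀ F : SchwartzMap (Fin n → EuclideanSpace ℝ (Fin 4)) ℂ, IsOffDiagonal F → ‖qcdLatticeDist (𝒞.scheme m) k n σ F‖ ≤ α * (n.factorial : ℝ) ^ β * schwartzNorm (n * s) F) ∧ (∀ ε : ℝ, 0 < ε → ∀ (n : ℕ) (σ : Fin n → QCDField Nf), ∀ᶠ k in Filter.atTop, ∀ F : SchwartzMap (Fin n → EuclideanSpace ℝ (Fin 4)) ℂ, IsOffDiagonal F → ‖qcdLatticeDistSymAP (𝒞.scheme m) k n σ F - qcdLatticeDist (𝒞.scheme m) k n σ F‖ ≤ ε * schwartzNorm (n * s) F)) → (∀ (n n' : ℕ) (σ : Fin n → QCDField Nf) (σ' : Fin n' → QCDField Nf) (F : SchwartzMap (Fin n → EuclideanSpace ℝ (Fin 4)) ℂ) (G : SchwartzMap (Fin n' → EuclideanSpace ℝ (Fin 4)) ℂ), IsTimeOrdered F → IsTimeOrdered G → ∀ a : EuclideanSpace ℝ (Fin 4), a 0 = 0 → a ≠ 0 → ∀ ε : ℝ, 0 < ε → ∃ t₀ : ℝ, ∀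 t : ℝ, t₀ ≤ t → ∀ H : SchwartzMap (Fin (n + n') → EuclideanSpace ℝ (Fin 4)) ℂ, IsAppendTensorOf H (osAdjoint F) (translateMulti (t • a) G) → ∀ᶠ k in Filter.atTop, ‖qcdLatticeDist (𝒞.scheme m) k (n + n') (Fin.append (σ ∘ Fin.rev) σ') H - qcdLatticeDist (𝒞.scheme m) k n (σ ∘ Fin.rev) (osAdjoint F) * qcdLatticeDist (𝒞.scheme m) k n' σ' G‖ ≤ ε) → (∃ Δ' > 0, (𝒞.scheme m).HasSpeciesCSClustering Δ') → ∃ S : LabelledSchwingerFamily (QCDField Nf) (EuclideanSpace ℝ (Fin 4)), S.IsNormalized ∧ S.IsHermitian ∧ S.HasLinearGrowth ∧ (∀ (n : ℕ) (σ : Fin n → QCDField Nf) (a : EuclideanSpace ℝ (Fin 4)) (F : SchwartzMap (Fin n → EuclideanSpace ℝ (Fin 4)) ℂ), IsOffDiagonal F → S n σ (translateMulti a F) = S n σ F) ∧ S.IsReflectionPositive ∧ S.IsSymmetric ∧ S.HasClusterProperty ∧ (∀ n : ℕ, n ≠ 0 → ∀ (σ : Fin n → QCDField Nf) (f : Fin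 n → SchwartzMap (EuclideanSpace ℝ (Fin 4)) ℝ) (F : SchwartzMap (Fin n → EuclideanSpace ℝ (Fin 4)) ℂ), IsTensorOf F (fun i => ofRealTest (f i)) → IsOffDiagonal F → Filter.Tendsto (fun k : ℕ => qcdLatticeSchwinger (𝒞.scheme m) k n σ f) Filter.atTop (nhds (S n σ F))) ∧ (∃ Δ : ℝ, 0 < Δ ∧ S.HasMassGap Δ ∧ (𝒞.scheme m).HasLatticeMassGap Δ) ∧ ((∀ (n : ℕ) (σ : Fin n → QCDField Nf) (Rot : EuclideanSpace ℝ (Fin 4) ≃ₗᵢ[ℝ] EuclideanSpace ℝ (Fin 4)), LinearMap.det (Rot.toLinearEquiv : EuclideanSpace ℝ (Fin 4) →ₗ[ℝ] EuclideanSpace ℝ (Fin 4)) = 1 → ∀ F : SchwartzMap (Fin n → EuclideanSpace ℝ (Fin 4)) ℂ, IsOffDiagonal F → S n σ (linActMulti Rot F) = S n σ F) → ∃ T : OSData (QCDField Nf) 4, T.schwinger = S ∧ T.IsNontrivial QCDField.glue ∧ T.IsNonGaussian QCDField.glue ∧ ∀ f g : Fin Nf, f ≠ g → T.IsNontrivial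 (QCDField.pseudoRe f g))

/-- The two route copies of the crux are the same proposition today. -/
theorem copies_agree :
    Summit.QuantumFields.QCD.Theses.GapBuysCauchyRate.ConvergentOSClosure ↔
      Summit.QuantumFields.QCD.Theses.CounterexampleMustBeHot.ConvergentOSClosure :=
  Iff.rfl

open Literature.MathematicalPhysics.AQFT Literature.MathematicalPhysics.QuantumLattice
  Literature.MathematicalPhysics.QuantumFieldTheory
open Summit.QuantumFields.QCD.Theorems.ConvergentOSClosure (stub_softClosure stub_asymptoticTranslation
  stub_speciesPackaging stub_rpOfComparison)

/-- **R′ is a theorem over the landed files** (this is the whole closing proof after the re-type). -/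
theorem convergentOSClosureRetyped_holds : ConvergentOSClosureRetyped := by
  intro Nf reg 𝒞 m hNf hm hAS hbr hgap h2g h2q h3g hconv hTC hcl hCS
  obtain ⟨s, α, β, hα, hb, hcomp⟩ := hTC
  have htr := stub_asymptoticTranslation Nf reg 𝒞 m hm hAS hbr hgap h2g h2q hconv s α β hα hb
  have hrp := stub_rpOfComparison Nf (𝒞.scheme m)
    (QCDScheme.eventually_le_beta_of_hasAsymptoticScaling hNf (𝒞.scheme m) hAS 0) hbr s α β hα hb hcomp
  obtain ⟨Δ, hΔ, hgapΔ⟩ := hgap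
  obtain ⟨Δ', hΔ', hCS'⟩ := hCS
  obtain ⟨S, h0, h0', hE0', hE1t, hE2, hE3, hE4, htensor, hgap₀⟩ :=
    stub_softClosure Nf (𝒞.scheme m) hconv s α β hα hb htr hrp hcl Δ Δ' hΔ hΔ' hgapΔ hCS'
  exact ⟨S, h0, h0', hE0', hE1t, hE2, hE3, hE4, htensor, hgap₀, fun hRot =>
    stub_speciesPackaging Nf reg 𝒞 m h2g h2q h3g S ⟨⟨h0, h0', ⟨hE1t, hRot⟩, hE2, hE3, hE4⟩, hE0'⟩ htensor⟩

/-- **Re-typing loses nothing**: the crux as typed implies R′. -/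
theorem retyped_of_original
    (h : Summit.QuantumFields.QCD.Theses.GapBuysCauchyRate.ConvergentOSClosure) : ConvergentOSClosureRetyped :=
  fun Nf reg 𝒞 m _ hm hAS hbr hgap h2g h2q h3g hconv _ _ _ =>
    h Nf reg 𝒞 m hm hAS hbr hgap h2g h2q h3g hconv

end Summit.QuantumFields.QCD.Cruxes.ConvergentOSClosure.Retype
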